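import Mathlib
import HarnessLib
import Summits.Langlands.Langlands.Theorems.ExteriorSquareAscentInducedSquareAscentRegroup
import Literature.NumberTheory.Automorphic.PairLFunctionBaseChange
import Literature.NumberTheory.Automorphic.KimExteriorSquareGL4

/-!
# The Euler-product identities (A) and (B') of the Klein-cube line (crux `InducedSquareAscent`)

For a quadratic Galois extension `L/K` (non-trivial automorphism `τ`), a finite set `S` of places
of `K` containing the ramified ones, a Satake family `α` over `K` (of `π`, rank 4) and `B` over `L`
(of `P`, rank 3) related by the INDUCED EXTERIOR-SQUARE MATCHING off `S` — `∧²(α v) = B w + B (τ • w)`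
for degree-one `w ∣ v`, `∧²(α v) = γ + (-γ)` with `γ² = B w` for degree-two `w ∣ v` — and value
functions `ωL w = (∏ α v)^{f(w|v)}` (the base change of the central character of `π`),
`Ω w = ∏ B w` (the central character of `P`), `εv v = ±1` (the quadratic sign), the partial
Rankin–Selberg Euler products (`partialPairL`, Arthur–Clozel Ch. 3 §2) satisfy, for every `s` at
which the products involved are multipliable:

* `kleinHelper_identityA` — **(A)**
  `L^T(B ⊗ ωL⁻¹B) · L^T(B ⊗ ωL⁻¹B^τ) = L^T(B ⊗ B⁻¹) · L^T(B ⊗ (B^τ)⁻¹)`, `T = {w : w ∩ 𝓞_K ∈ S}`;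
* `kleinHelper_identityB` — **(B')**
  `L^S(α ⊗ α⁻¹) · L^S(α ⊗ ε α⁻¹) = L^S(1 ⊗ 1) · L^S(1 ⊗ ε) · L^T((Ω ωL⁻¹)B⁻¹ ⊗ 1)² · L^T(B ⊗ ωL⁻¹B^τ)`.

Both are obtained by regrouping the `L`-side products along `w ↦ w ∩ 𝓞_K`
(`regroup_tprod`, `regroup_tprod'` of `…InducedSquareAscentRegroup`) and the local Satake identities
(3), (4) resp. (1), (2) of the line (`stub_localIdentities`), which are taken here as HYPOTHESES
(`hLI3`, `hLI4`, `hLI1`, `hLI2`) verbatim. No named fact is used.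
-/

set_option linter.unusedVariables false
set_option linter.dupNamespace false

noncomputable section

namespace Summit.Langlands.Langlands.Theorems.InducedSquareAscentKleinCube

open scoped Classical NumberField Topology
open Filter IsDedekindDomain NumberField
open Literature.NumberTheory.Automorphic

variable {K L : Type} [Field K] [NumberField K] [Field L] [NumberField L] [Algebra K L]

/-! ### Local variables at the places of `L` over an unramified place -/

/-- At a degree-`f` place `w ∣ v`: `q_w^{-s} = (q_v^{-s})^f`. [folklore] -/
theorem residueCard_cpow_neg_eq_pow (w : HeightOneSpectrum (𝓞 L)) (s : ℂ) :
    (w.residueCard : ℂ) ^ (-s) =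
      (((w.under (𝓞 K)).residueCard : ℂ) ^ (-s)) ^ w.asIdeal.inertiaDeg (𝓞 K) := by
  rw [residueCard_eq_pow_inertiaDeg (F := K) w, Nat.cast_pow, ← Complex.natCast_cpow_natCast_mul,
    Complex.cpow_nat_mul]

omit [NumberField K] [NumberField L] in
/-- The residue degree is `τ`-invariant. [folklore] -/
theorem inertiaDeg_smul_eq (τ : L ≃ₐ[K] L) (w : HeightOneSpectrum (𝓞 L)) :
    (τ • w).asIdeal.inertiaDeg (𝓞 K) = w.asIdeal.inertiaDeg (𝓞 K) :=
  HeightOneSpectrum.inertiaDeg_algEquiv_smul K L τ w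

/-! ### Identity (A) -/

/-- **Identity (A) of the Klein-cube line** (`L^T(P×P⊗ω_L⁻¹)·L^T(P×P^τ⊗ω_L⁻¹) = L^T(P×P^∨)·L^T(P×P^{τ∨})`
on Satake families): both sides regroup over `v ∉ S` to `∏_v L_v(∧²t_π ⊗ ω⁻¹∧²t_π)`, by the local
identity (3) at split places and the duality `β⁻¹ = ω⁻²β` (4) at inert places (hypotheses `hLI3`,
`hLI4`, verbatim conjuncts of `stub_localIdentities`). [cite: ArthurClozelAMS120, Ch. 3, Lemma 4.3] -/
theorem kleinHelper_identityA :
    ∀ (K L : Type) [Field K] [NumberField K] [Field L] [NumberField L] [Algebra K L] [IsGalois K L],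
      Module.finrank K L = 2 → ∀ (τ : L ≃ₐ[K] L), τ ≠ 1 →
      (∀ (x : ℂ) (α β₁ β₂ : Multiset ℂ), Multiset.card α = 4 → (∀ a ∈ α, a ≠ 0) →
        Multiset.card β₁ = 3 → Multiset.card β₂ = 3 → wedgeTwoParams α = β₁ + β₂ →
        ((satakePairPolynomial β₁ (β₁.map (fun b => (α.prod)⁻¹ * b))).eval x) *
          ((satakePairPolynomial β₂ (β₂.map (fun b => (α.prod)⁻¹ * b))).eval x) *
          (((satakePairPolynomial β₁ (β₂.map (fun b => (α.prod)⁻¹ * b))).eval x) *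
            ((satakePairPolynomial β₂ (β₁.map (fun b => (α.prod)⁻¹ * b))).eval x)) =
        ((satakePairPolynomial β₁ (β₁.map (fun b => b⁻¹))).eval x) *
          ((satakePairPolynomial β₂ (β₂.map (fun b => b⁻¹))).eval x) *
          (((satakePairPolynomial β₁ (β₂.map (fun b => b⁻¹))).eval x) *
            ((satakePairPolynomial β₂ (β₁.map (fun b => b⁻¹))).eval x))) →
      (∀ (α γ : Multiset ℂ), Multiset.card α = 4 → (∀ a ∈ α, a ≠ 0) →
        Multiset.card γ = 3 → wedgeTwoParams α = γ + γ.map (fun c => -c) →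
        (γ.map (fun c => c ^ 2)).map (fun b => b⁻¹) =
          (γ.map (fun c => c ^ 2)).map (fun b => ((α.prod) ^ 2)⁻¹ * b)) →
      ∀ (S : Set (HeightOneSpectrum (𝓞 K))) (α : SatakeFamily K) (B : SatakeFamily L)
        (ωL : HeightOneSpectrum (𝓞 L) → ℂ),
      (∀ v ∉ S, v.asIdeal.ramificationIdxIn (𝓞 L) = 1) →
      (∀ v ∉ S, Multiset.card (α v) = 4 ∧ ∀ a ∈ α v, a ≠ 0) →
      (∀ w : HeightOneSpectrum (𝓞 L), w.under (𝓞 K) ∉ S → Multiset.card (B w) = 3) →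
      (∀ w : HeightOneSpectrum (𝓞 L), w.under (𝓞 K) ∉ S →
        ωL w = (α (w.under (𝓞 K))).prod ^ w.asIdeal.inertiaDeg (𝓞 K)) →
      (∀ v ∉ S, ∀ w : HeightOneSpectrum (𝓞 L), w.under (𝓞 K) = v →
        w.asIdeal.inertiaDeg (𝓞 K) = 1 → wedgeTwoParams (α v) = B w + B (τ • w)) →
      (∀ v ∉ S, ∀ w : HeightOneSpectrum (𝓞 L), w.under (𝓞 K) = v →
        w.asIdeal.inertiaDeg (𝓞 K) = 2 → ∃ γ : Multiset ℂ, Multiset.card γ = 3 ∧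
          γ.map (fun c => c ^ 2) = B w ∧ wedgeTwoParams (α v) = γ + γ.map (fun c => -c)) →
      ∀ (s : ℂ),
      Multipliable (fun w : {w : HeightOneSpectrum (𝓞 L) // w.under (𝓞 K) ∉ S} =>
        ((satakePairPolynomial (B w.1) ((B w.1).map (fun b => (ωL w.1)⁻¹ * b))).eval
          ((w.1.residueCard : ℂ) ^ (-s)))⁻¹) →
      Multipliable (fun w : {w : HeightOneSpectrum (𝓞 L) // w.under (𝓞 K) ∉ S} =>
        ((satakePairPolynomial (B w.1) ((B (τ • w.1)).map (fun b => (ωL w.1)⁻¹ * b))).eval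
          ((w.1.residueCard : ℂ) ^ (-s)))⁻¹) →
      Multipliable (fun w : {w : HeightOneSpectrum (𝓞 L) // w.under (𝓞 K) ∉ S} =>
        ((satakePairPolynomial (B w.1) ((B w.1).map (fun b => b⁻¹))).eval
          ((w.1.residueCard : ℂ) ^ (-s)))⁻¹) →
      Multipliable (fun w : {w : HeightOneSpectrum (𝓞 L) // w.under (𝓞 K) ∉ S} =>
        ((satakePairPolynomial (B w.1) ((B (τ • w.1)).map (fun b => b⁻¹))).eval
          ((w.1.residueCard : ℂ) ^ (-s)))⁻¹) →
      partialPairL {w : HeightOneSpectrum (𝓞 L) | w.under (𝓞 K) ∈ S} B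
          (fun w => (B w).map (fun b => (ωL w)⁻¹ * b)) s *
        partialPairL {w : HeightOneSpectrum (𝓞 L) | w.under (𝓞 K) ∈ S} B
          (fun w => (B (τ • w)).map (fun b => (ωL w)⁻¹ * b)) s =
      partialPairL {w : HeightOneSpectrum (𝓞 L) | w.under (𝓞 K) ∈ S} B
          (fun w => (B w).map (fun b => b⁻¹)) s *
        partialPairL {w : HeightOneSpectrum (𝓞 L) | w.under (𝓞 K) ∈ S} B
          (fun w => (B (τ • w)).map (fun b => b⁻¹)) s := by
  intro K L _ _ _ _ _ _ hdeg τ hτ hLI3 hLI4 S α B ωL hS hα hB hωL hsplit hinert s hma hmb hmd hme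
  -- the four Euler factors, as functions on the places of `L`
  set fa : HeightOneSpectrum (𝓞 L) → ℂ := fun w =>
    ((satakePairPolynomial (B w) ((B w).map (fun b => (ωL w)⁻¹ * b))).eval
      ((w.residueCard : ℂ) ^ (-s)))⁻¹ with hfa
  set fb : HeightOneSpectrum (𝓞 L) → ℂ := fun w =>
    ((satakePairPolynomial (B w) ((B (τ • w)).map (fun b => (ωL w)⁻¹ * b))).eval
      ((w.residueCard : ℂ) ^ (-s)))⁻¹ with hfb
  set fd : HeightOneSpectrum (𝓞 L) → ℂ := fun w =>
    ((satakePairPolynomial (B w) ((B w).map (fun b => b⁻¹))).eval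
      ((w.residueCard : ℂ) ^ (-s)))⁻¹ with hfd
  set fe : HeightOneSpectrum (𝓞 L) → ℂ := fun w =>
    ((satakePairPolynomial (B w) ((B (τ • w)).map (fun b => b⁻¹))).eval
      ((w.residueCard : ℂ) ^ (-s)))⁻¹ with hfe
  have hLa : partialPairL {w : HeightOneSpectrum (𝓞 L) | w.under (𝓞 K) ∈ S} B
      (fun w => (B w).map (fun b => (ωL w)⁻¹ * b)) s =
      ∏' w : {w : HeightOneSpectrum (𝓞 L) // w.under (𝓞 K) ∉ S}, fa w.1 := rfl
  have hLb : partialPairL {w : HeightOneSpectrum (𝓞 L) | w.under (𝓞 K) ∈ S} B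
      (fun w => (B (τ • w)).map (fun b => (ωL w)⁻¹ * b)) s =
      ∏' w : {w : HeightOneSpectrum (𝓞 L) // w.under (𝓞 K) ∉ S}, fb w.1 := rfl
  have hLd : partialPairL {w : HeightOneSpectrum (𝓞 L) | w.under (𝓞 K) ∈ S} B
      (fun w => (B w).map (fun b => b⁻¹)) s =
      ∏' w : {w : HeightOneSpectrum (𝓞 L) // w.under (𝓞 K) ∉ S}, fd w.1 := rfl
  have hLe : partialPairL {w : HeightOneSpectrum (𝓞 L) | w.under (𝓞 K) ∈ S} B
      (fun w => (B (τ • w)).map (fun b => b⁻¹)) s =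
      ∏' w : {w : HeightOneSpectrum (𝓞 L) // w.under (𝓞 K) ∉ S}, fe w.1 := rfl
  rw [hLa, hLb, hLd, hLe, ← Multipliable.tprod_mul hma hmb, ← Multipliable.tprod_mul hmd hme]
  refine regroup_tprod' hdeg hτ S (fun w => fa w * fb w) (fun w => fd w * fe w) hS ?_ ?_
    (hma.mul hmb) (hmd.mul hme)
  · -- split places: local identity (3)
    intro v hv w hw hf
    have hvS : w.under (𝓞 K) ∉ S := by rw [hw]; exact hv
    have hτw : (τ • w).under (𝓞 K) = v := by rw [HeightOneSpectrum.under_algEquiv_smul, hw]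
    have hτvS : (τ • w).under (𝓞 K) ∉ S := by rw [hτw]; exact hv
    have hfτ : (τ • w).asIdeal.inertiaDeg (𝓞 K) = 1 := by rw [inertiaDeg_smul_eq, hf]
    have hωw : ωL w = (α v).prod := by rw [hωL w hvS, hw, hf, pow_one]
    have hωτ : ωL (τ • w) = (α v).prod := by rw [hωL _ hτvS, hτw, hfτ, pow_one]
    have hq : ((τ • w).residueCard : ℂ) = (w.residueCard : ℂ) := by
      obtain ⟨-, hq1, -⟩ := fibre_of_inertiaDeg_eq_one hdeg hτ (hS v hv) hw hf
      obtain ⟨-, hq2, -⟩ := fibre_of_inertiaDeg_eq_one hdeg hτ (hS v hv) hτw hfτ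
      rw [hq1, hq2]
    have hττ : τ • τ • w = w := smul_smul_eq_self hdeg τ w
    have key := hLI3 ((w.residueCard : ℂ) ^ (-s)) (α v) (B w) (B (τ • w)) (hα v hv).1 (hα v hv).2
      (hB w hvS) (hB _ hτvS) (hsplit v hv w hw hf)
    simp only [hfa, hfb, hfd, hfe, hττ, hωw, hωτ, hq]
    rw [← mul_inv, ← mul_inv, ← mul_inv, ← mul_inv, ← mul_inv, ← mul_inv]
    congr 1
    linear_combination key
  · -- inert places: `fa = fb`, `fd = fe`, and `β⁻¹ = ω⁻²β` (4)
    intro v hv w hw hf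
    have hvS : w.under (𝓞 K) ∉ S := by rw [hw]; exact hv
    obtain ⟨γ, hγ3, hγB, hγα⟩ := hinert v hv w hw hf
    have hne : ¬ ∃ w : HeightOneSpectrum (𝓞 L), w.under (𝓞 K) = v ∧
        w.asIdeal.inertiaDeg (𝓞 K) = 1 := by
      rintro ⟨w₀, hw₀, hf₀⟩
      have := inertiaDeg_eq_of_under_eq (K := K) (hw.trans hw₀.symm)
      omega
    obtain ⟨w₀, hw₀, -, hτw₀, -, hall⟩ := fibre_of_not_exists_inertiaDeg_eq_one hdeg hτ (hS v hv) hne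
    have hww : w = w₀ := hall w hw
    have hτw : τ • w = w := by rw [hww, hτw₀]
    have hωw : ωL w = (α v).prod ^ 2 := by rw [hωL w hvS, hw, hf]
    have hdual := hLI4 (α v) γ (hα v hv).1 (hα v hv).2 hγ3 hγα
    rw [hγB] at hdual
    simp only [hfa, hfb, hfd, hfe, hτw, hωw, hdual]

/-! ### Identity (B') -/

/-- `1 - c x ≠ 0` for `|c| = 1`, `|x| < 1`: the rank-one Euler factors at `Re s > 0` do not vanish.
[folklore] -/
theorem eval_satakePairPolynomial_singleton_ne_zero {c x : ℂ} (hc : ‖c‖ = 1) (hx : ‖x‖ < 1) :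
    (satakePairPolynomial ({1} : Multiset ℂ) ({c} : Multiset ℂ)).eval x ≠ 0 := by
  have h : (satakePairPolynomial ({1} : Multiset ℂ) ({c} : Multiset ℂ)).eval x = 1 - c * x := by
    simp [satakePairPolynomial]
  rw [h, sub_ne_zero]
  intro h1
  have : ‖c * x‖ = 1 := by rw [← h1, norm_one]
  rw [norm_mul, hc, one_mul] at this
  linarith

/-- `|q_v^{-s}| < 1` for `Re s > 0`. [folklore] -/
theorem norm_residueCard_cpow_neg_lt_one (v : HeightOneSpectrum (𝓞 K)) {s : ℂ} (hs : 0 < s.re) :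
    ‖(v.residueCard : ℂ) ^ (-s)‖ < 1 := by
  have hq : 1 < (v.residueCard : ℝ) := by exact_mod_cast v.one_lt_residueCard
  rw [Complex.norm_natCast_cpow_of_pos (Nat.zero_lt_of_lt v.one_lt_residueCard), Complex.neg_re]
  exact Real.rpow_lt_one_of_one_lt_of_neg hq (by linarith)

/-- **Identity (B') of the Klein-cube line**
(`L^S(π×π^∨)·L^S(π×π^∨⊗ε) = ζ_K^S·L^S(ε)·L^T(P^∨⊗ω_Pω_L⁻¹)²·L^T(P×P^τ⊗ω_L⁻¹)` on Satake families):
the `L`-side products regroup over `v ∉ S` (`regroup_tprod`) and the local identities (1) (split `v`,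
where `ε(v) = 1`) and (2) (inert `v`, where `ε(v) = -1`, `q_w = q_v²`) of `stub_localIdentities`
(hypotheses `hLI1`, `hLI2`) identify the fibre products. Valid at every `s` with `Re s > 0` at which
the six Euler products are multipliable. [cite: ArthurClozelAMS120, Ch. 3, Lemma 4.3] -/
theorem kleinHelper_identityB :
    ∀ (K L : Type) [Field K] [NumberField K] [Field L] [NumberField L] [Algebra K L] [IsGalois K L], Module.finrank K L = 2 → ∀ (τ : L ≃ₐ[K] L), τ ≠ 1 → (∀ (x : ℂ) (α β₁ β₂ : Multiset ℂ), Multiset.card α = 4 → (∀ a ∈ α, a ≠ 0) → Multiset.card β₁ = 3 → Multiset.card β₂ = 3 → wedgeTwoParams α = β₁ + β₂ → ((satakePairPolynomial α (α.map (·⁻¹))).eval x) ^ 2 = ((satakePairPolynomial ({1} : Multiset ℂ) ({1} : Multiset ℂ)).eval x) ^ 2 * (((satakePairPolynomial ((β₁.map (·⁻¹)).map ((β₁.prod * (α.prod)⁻¹) * ·)) ({1} : Multiset ℂ)).eval x) * ((satakePairPolynomial ((β₂.map (·⁻¹)).map ((β₂.prod * (α.prod)⁻¹) * ·)) ({1}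 : Multiset ℂ)).eval x)) ^ 2 * (((satakePairPolynomial β₁ (β₂.map ((α.prod)⁻¹ * ·))).eval x) * ((satakePairPolynomial β₂ (β₁.map ((α.prod)⁻¹ * ·))).eval x))) → (∀ (x : ℂ) (α γ : Multiset ℂ), Multiset.card α = 4 → (∀ a ∈ α, a ≠ 0) → Multiset.card γ = 3 → wedgeTwoParams α = γ + γ.map (-·) → ((satakePairPolynomial α (α.map (·⁻¹))).eval x) * ((satakePairPolynomial α ((α.map (·⁻¹)).map ((-1 : ℂ) * ·))).eval x) = ((satakePairPolynomial ({1} : Multiset ℂ) ({1} : Multiset ℂ)).eval x) * ((satakePairPolynomial ({1} : Multiset ℂ) ({-1} : Multiset ℂ)).eval x) * ((satakePairPolynomial (((γ.map (· ^ 2)).map (·⁻¹)).map (((γ.map (· ^ 2)).prod * ((α.prod) ^ 2)⁻¹) * ·)) ({1} : Multiset ℂ)).eval (x ^ 2)) ^ 2 * ((satakePairPolynomial (γ.map (· ^ 2)) ((γ.map (· ^ 2)).map (((α.prod) ^ 2)⁻¹ * ·))).eval (x ^ 2))) → ∀ (S : Set (HeightOneSpectrum (𝓞 K))) (α : SatakeFamily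 K) (B : SatakeFamily L) (εv : HeightOneSpectrum (𝓞 K) → ℂ) (ωL Ω : HeightOneSpectrum (𝓞 L) → ℂ), (∀ v ∉ S, v.asIdeal.ramificationIdxIn (𝓞 L) = 1) → (∀ v ∉ S, Multiset.card (α v) = 4 ∧ ∀ a ∈ α v, a ≠ 0) → (∀ w : HeightOneSpectrum (𝓞 L), w.under (𝓞 K) ∉ S → Multiset.card (B w) = 3) → (∀ w : HeightOneSpectrum (𝓞 L), w.under (𝓞 K) ∉ S → ωL w = (α (w.under (𝓞 K))).prod ^ w.asIdeal.inertiaDeg (𝓞 K)) → (∀ w : HeightOneSpectrum (𝓞 L), w.under (𝓞 K) ∉ S → Ω w = (B w).prod) → (∀ v ∉ S, ∀ w : HeightOneSpectrum (𝓞 L), w.under (𝓞 K) = v → w.asIdeal.inertiaDeg (𝓞 K) = 1 → εv v = 1 ∧ wedgeTwoParams (α v) = B w + B (τ • w)) → (∀ v ∉ S, ∀ w : HeightOneSpectrum (𝓞 L), w.under (𝓞 K) = v → w.asIdeal.inertiaDeg (𝓞 K) = 2 → εv v = -1 ∧ ∃ γ : Multiset ℂ, Multiset.card γ = 3 ∧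 γ.map (· ^ 2) = B w ∧ wedgeTwoParams (α v) = γ + γ.map (-·)) → ∀ (s : ℂ), 0 < s.re → Multipliable (fun v : {v : HeightOneSpectrum (𝓞 K) // v ∉ S} => ((satakePairPolynomial (α v.1) ((α v.1).map (·⁻¹))).eval ((v.1.residueCard : ℂ) ^ (-s)))⁻¹) → Multipliable (fun v : {v : HeightOneSpectrum (𝓞 K) // v ∉ S} => ((satakePairPolynomial (α v.1) (((α v.1).map (·⁻¹)).map (εv v.1 * ·))).eval ((v.1.residueCard : ℂ) ^ (-s)))⁻¹) → Multipliable (fun v : {v : HeightOneSpectrum (𝓞 K) // v ∉ S} => ((satakePairPolynomial ({1} : Multiset ℂ) ({1} : Multiset ℂ)).eval ((v.1.residueCard : ℂ) ^ (-s)))⁻¹) → Multipliable (fun v : {v : HeightOneSpectrum (𝓞 K) // v ∉ S} => ((satakePairPolynomial ({1} : Multiset ℂ) ({εv v.1} : Multiset ℂ)).eval ((v.1.residueCard : ℂ) ^ (-s)))⁻¹) → Multipliable (fun w : {w : HeightOneSpectrum (𝓞 L) // w.under (𝓞 K) ∉ S} => ((satakePairPolynomial (((B w.1).map (·⁻¹)).map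 ((Ω w.1 * (ωL w.1)⁻¹) * ·)) ({1} : Multiset ℂ)).eval ((w.1.residueCard : ℂ) ^ (-s)))⁻¹) → Multipliable (fun w : {w : HeightOneSpectrum (𝓞 L) // w.under (𝓞 K) ∉ S} => ((satakePairPolynomial (B w.1) ((B (τ • w.1)).map ((ωL w.1)⁻¹ * ·))).eval ((w.1.residueCard : ℂ) ^ (-s)))⁻¹) → partialPairL S α (fun v => (α v).map (·⁻¹)) s * partialPairL S α (fun v => ((α v).map (·⁻¹)).map (εv v * ·)) s = partialPairL S (fun _ => ({1} : Multiset ℂ)) (fun _ => ({1} : Multiset ℂ)) s * partialPairL S (fun _ => ({1} : Multiset ℂ)) (fun v => ({εv v} : Multiset ℂ)) s * (partialPairL {w : HeightOneSpectrum (𝓞 L) | w.under (𝓞 K) ∈ S} (fun w => ((B w).map (·⁻¹)).map ((Ω w * (ωL w)⁻¹) * ·)) (fun _ => ({1} : Multiset ℂ)) s) ^ 2 * partialPairL {w : HeightOneSpectrum (𝓞 L) | w.under (𝓞 K) ∈ S} B (fun w => (B (τ • w)).map ((ωL w)⁻¹ * ·)) s := by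
  intro K L _ _ _ _ _ _ hdeg τ hτ hLI1 hLI2 S α B εv ωL Ω hS hα hB hωL hΩ hsplit hinert s hs
    hm1 hm2 hmζ hmε hmc hmb
  -- Euler factors
  set f₁ : HeightOneSpectrum (𝓞 K) → ℂ := fun v =>
    ((satakePairPolynomial (α v) ((α v).map (fun a => a⁻¹))).eval ((v.residueCard : ℂ) ^ (-s)))⁻¹
    with hf₁
  set f₂ : HeightOneSpectrum (𝓞 K) → ℂ := fun v =>
    ((satakePairPolynomial (α v) (((α v).map (fun a => a⁻¹)).map (fun a => εv v * a))).eval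
      ((v.residueCard : ℂ) ^ (-s)))⁻¹ with hf₂
  set fζ : HeightOneSpectrum (𝓞 K) → ℂ := fun v =>
    ((satakePairPolynomial ({1} : Multiset ℂ) ({1} : Multiset ℂ)).eval ((v.residueCard : ℂ) ^ (-s)))⁻¹
    with hfζ
  set fε : HeightOneSpectrum (𝓞 K) → ℂ := fun v =>
    ((satakePairPolynomial ({1} : Multiset ℂ) ({εv v} : Multiset ℂ)).eval
      ((v.residueCard : ℂ) ^ (-s)))⁻¹ with hfε
  set fc : HeightOneSpectrum (𝓞 L) → ℂ := fun w =>
    ((satakePairPolynomial (((B w).map (fun b => b⁻¹)).map (fun b => (Ω w * (ωL w)⁻¹) * b))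
      ({1} : Multiset ℂ)).eval ((w.residueCard : ℂ) ^ (-s)))⁻¹ with hfc
  set fb : HeightOneSpectrum (𝓞 L) → ℂ := fun w =>
    ((satakePairPolynomial (B w) ((B (τ • w)).map (fun b => (ωL w)⁻¹ * b))).eval
      ((w.residueCard : ℂ) ^ (-s)))⁻¹ with hfb
  -- the `K`-side function matching the fibre products of `fc² · fb`
  set h : HeightOneSpectrum (𝓞 K) → ℂ := fun v => f₁ v * f₂ v * (fζ v * fε v)⁻¹ with hh
  -- non-vanishing of the rank-one factors
  have hx : ∀ v : HeightOneSpectrum (𝓞 K), ‖(v.residueCard : ℂ) ^ (-s)‖ < 1 := fun v =>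
    norm_residueCard_cpow_neg_lt_one v hs
  have hζne : ∀ v : HeightOneSpectrum (𝓞 K), fζ v ≠ 0 := fun v => by
    simp only [hfζ]
    exact inv_ne_zero (eval_satakePairPolynomial_singleton_ne_zero (by simp) (hx v))
  have hεne : ∀ v ∉ S, fε v ≠ 0 := by
    intro v hv
    have hε1 : ‖εv v‖ = 1 := by
      -- `v ∉ S` is unramified; it is split or inert, and `εv v = ±1` accordingly
      by_cases hex : ∃ w : HeightOneSpectrum (𝓞 L), w.under (𝓞 K) = v ∧ w.asIdeal.inertiaDeg (𝓞 K) = 1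
      · obtain ⟨w, hw, hf⟩ := hex
        rw [(hsplit v hv w hw hf).1, norm_one]
      · obtain ⟨w, hw, hf, -⟩ := fibre_of_not_exists_inertiaDeg_eq_one hdeg hτ (hS v hv) hex
        rw [(hinert v hv w hw hf).1, norm_neg, norm_one]
    simp only [hfε]
    exact inv_ne_zero (eval_satakePairPolynomial_singleton_ne_zero hε1 (hx v))
  -- fibre identities for the regrouping of the `L`-side product `fc² · fb`
  have hs_fib : ∀ v ∉ S, ∀ w : HeightOneSpectrum (𝓞 L), w.under (𝓞 K) = v →
      w.asIdeal.inertiaDeg (𝓞 K) = 1 →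
      (fun w => fc w ^ 2 * fb w) w * (fun w => fc w ^ 2 * fb w) (τ • w) = h v := by
    -- split places: identity (1) with `ε(v) = 1`
    intro v hv w hw hf
    have hvS : w.under (𝓞 K) ∉ S := by rw [hw]; exact hv
    have hτw : (τ • w).under (𝓞 K) = v := by rw [HeightOneSpectrum.under_algEquiv_smul, hw]
    have hτvS : (τ • w).under (𝓞 K) ∉ S := by rw [hτw]; exact hv
    have hfτ : (τ • w).asIdeal.inertiaDeg (𝓞 K) = 1 := by rw [inertiaDeg_smul_eq, hf]
    obtain ⟨hε, hwedge⟩ := hsplit v hv w hw hf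
    have hωw : ωL w = (α v).prod := by rw [hωL w hvS, hw, hf, pow_one]
    have hωτ : ωL (τ • w) = (α v).prod := by rw [hωL _ hτvS, hτw, hfτ, pow_one]
    have hΩw : Ω w = (B w).prod := hΩ w hvS
    have hΩτ : Ω (τ • w) = (B (τ • w)).prod := hΩ _ hτvS
    have hq : ((τ • w).residueCard : ℂ) = (w.residueCard : ℂ) := by
      obtain ⟨-, hq1, -⟩ := fibre_of_inertiaDeg_eq_one hdeg hτ (hS v hv) hw hf
      obtain ⟨-, hq2, -⟩ := fibre_of_inertiaDeg_eq_one hdeg hτ (hS v hv) hτw hfτ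
      rw [hq1, hq2]
    have hqv : (w.residueCard : ℂ) = (v.residueCard : ℂ) := by
      obtain ⟨-, hq1, -⟩ := fibre_of_inertiaDeg_eq_one hdeg hτ (hS v hv) hw hf
      rw [hq1]
    have hττ : τ • τ • w = w := smul_smul_eq_self hdeg τ w
    have key := hLI1 ((v.residueCard : ℂ) ^ (-s)) (α v) (B w) (B (τ • w)) (hα v hv).1 (hα v hv).2
      (hB w hvS) (hB _ hτvS) hwedge
    have hζv := hζne v
    simp only [hh, hf₁, hf₂, hfζ, hfε, hfc, hfb, hττ, hωw, hωτ, hΩw, hΩτ, hq, hqv, hε, one_mul,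
      Multiset.map_id'] at hζv ⊢
    -- abbreviate the evaluated polynomials
    set x := (v.residueCard : ℂ) ^ (-s) with hxdef
    set Pαα := (satakePairPolynomial (α v) ((α v).map (fun a => a⁻¹))).eval x
    set P11 := (satakePairPolynomial ({1} : Multiset ℂ) ({1} : Multiset ℂ)).eval x
    set PV1 := (satakePairPolynomial (((B w).map (fun b => b⁻¹)).map
      (fun b => ((B w).prod * ((α v).prod)⁻¹) * b)) ({1} : Multiset ℂ)).eval x
    set PV2 := (satakePairPolynomial (((B (τ • w)).map (fun b => b⁻¹)).map
      (fun b => ((B (τ • w)).prod * ((α v).prod)⁻¹) * b)) ({1} : Multiset ℂ)).eval x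
    set Pb12 := (satakePairPolynomial (B w) ((B (τ • w)).map (fun b => ((α v).prod)⁻¹ * b))).eval x
    set Pb21 := (satakePairPolynomial (B (τ • w)) ((B w).map (fun b => ((α v).prod)⁻¹ * b))).eval x
    have hP11 : P11 ≠ 0 := fun h0 => hζv (by rw [h0, inv_zero])
    -- `key : Pαα ^ 2 = P11 ^ 2 * (PV1 * PV2) ^ 2 * (Pb12 * Pb21)`
    have hprod : P11 ^ 2 * ((PV1 * PV2) ^ 2 * (Pb12 * Pb21)) = Pαα ^ 2 := by rw [key]; ring
    have hgoal : (PV1⁻¹) ^ 2 * Pb12⁻¹ * ((PV2⁻¹) ^ 2 * Pb21⁻¹) =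
        Pαα⁻¹ * Pαα⁻¹ * (P11⁻¹ * P11⁻¹)⁻¹ := by
      calc (PV1⁻¹) ^ 2 * Pb12⁻¹ * ((PV2⁻¹) ^ 2 * Pb21⁻¹)
          = ((PV1 * PV2) ^ 2 * (Pb12 * Pb21))⁻¹ := by ring
        _ = (P11 ^ 2 * ((PV1 * PV2) ^ 2 * (Pb12 * Pb21)))⁻¹ * P11 ^ 2 := by field_simp
        _ = (Pαα ^ 2)⁻¹ * P11 ^ 2 := by rw [hprod]
        _ = Pαα⁻¹ * Pαα⁻¹ * (P11⁻¹ * P11⁻¹)⁻¹ := by simp only [mul_inv, inv_inv]; ring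
    exact hgoal
  have hi_fib : ∀ v ∉ S, ∀ w : HeightOneSpectrum (𝓞 L), w.under (𝓞 K) = v →
      w.asIdeal.inertiaDeg (𝓞 K) = 2 → (fun w => fc w ^ 2 * fb w) w = h v := by
    -- inert places: identity (2) with `ε(v) = -1`, `q_w = q_v²`
    intro v hv w hw hf
    have hvS : w.under (𝓞 K) ∉ S := by rw [hw]; exact hv
    obtain ⟨hε, γ, hγ3, hγB, hγα⟩ := hinert v hv w hw hf
    have hne : ¬ ∃ w : HeightOneSpectrum (𝓞 L), w.under (𝓞 K) = v ∧
        w.asIdeal.inertiaDeg (𝓞 K) = 1 := by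
      rintro ⟨w₀, hw₀, hf₀⟩
      have := inertiaDeg_eq_of_under_eq (K := K) (hw.trans hw₀.symm)
      omega
    obtain ⟨w₀, hw₀, -, hτw₀, hq₀, hall⟩ := fibre_of_not_exists_inertiaDeg_eq_one hdeg hτ (hS v hv) hne
    have hww : w = w₀ := hall w hw
    have hτw : τ • w = w := by rw [hww, hτw₀]
    have hωw : ωL w = (α v).prod ^ 2 := by rw [hωL w hvS, hw, hf]
    have hΩw : Ω w = (B w).prod := hΩ w hvS
    have hq : (w.residueCard : ℂ) ^ (-s) = ((v.residueCard : ℂ) ^ (-s)) ^ 2 := by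
      rw [residueCard_cpow_neg_eq_pow (K := K) w s, hw, hf]
    have key := hLI2 ((v.residueCard : ℂ) ^ (-s)) (α v) γ (hα v hv).1 (hα v hv).2 hγ3 hγα
    rw [hγB] at key
    have hζv := hζne v
    have hεv := hεne v hv
    simp only [hh, hf₁, hf₂, hfζ, hfε, hfc, hfb, hτw, hωw, hΩw, hq, hε] at hζv hεv ⊢
    set x := (v.residueCard : ℂ) ^ (-s) with hxdef
    set Pαα := (satakePairPolynomial (α v) ((α v).map (fun a => a⁻¹))).eval x
    set Pαε := (satakePairPolynomial (α v) (((α v).map (fun a => a⁻¹)).map (fun a => (-1 : ℂ) * a))).eval x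
    set P11 := (satakePairPolynomial ({1} : Multiset ℂ) ({1} : Multiset ℂ)).eval x
    set P1ε := (satakePairPolynomial ({1} : Multiset ℂ) ({-1} : Multiset ℂ)).eval x
    set PV := (satakePairPolynomial (((B w).map (fun b => b⁻¹)).map
      (fun b => ((B w).prod * ((α v).prod ^ 2)⁻¹) * b)) ({1} : Multiset ℂ)).eval (x ^ 2)
    set Pb := (satakePairPolynomial (B w) ((B w).map (fun b => ((α v).prod ^ 2)⁻¹ * b))).eval (x ^ 2)
    have hP11 : P11 ≠ 0 := fun h0 => hζv (by rw [h0, inv_zero])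
    have hP1ε : P1ε ≠ 0 := fun h0 => hεv (by rw [h0, inv_zero])
    -- `key : Pαα * Pαε = P11 * P1ε * PV ^ 2 * Pb`
    have hprod : P11 * P1ε * (PV ^ 2 * Pb) = Pαα * Pαε := by rw [key]; ring
    have hgoal : (PV⁻¹) ^ 2 * Pb⁻¹ = Pαα⁻¹ * Pαε⁻¹ * (P11⁻¹ * P1ε⁻¹)⁻¹ := by
      calc (PV⁻¹) ^ 2 * Pb⁻¹ = (PV ^ 2 * Pb)⁻¹ := by ring
        _ = (P11 * P1ε * (PV ^ 2 * Pb))⁻¹ * (P11 * P1ε) := by field_simp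
        _ = (Pαα * Pαε)⁻¹ * (P11 * P1ε) := by rw [hprod]
        _ = Pαα⁻¹ * Pαε⁻¹ * (P11⁻¹ * P1ε⁻¹)⁻¹ := by simp only [mul_inv, inv_inv]
    exact hgoal
  obtain ⟨hmh, hreg⟩ := regroup_tprod hdeg hτ S (fun w => fc w ^ 2 * fb w) h hS hs_fib hi_fib
    ((hmc.pow 2).mul hmb)
  -- assemble
  have hLHS : partialPairL S α (fun v => (α v).map (fun a => a⁻¹)) s *
      partialPairL S α (fun v => ((α v).map (fun a => a⁻¹)).map (fun a => εv v * a)) s =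
      ∏' v : {v : HeightOneSpectrum (𝓞 K) // v ∉ S}, (f₁ v.1 * f₂ v.1) := by
    rw [Multipliable.tprod_mul hm1 hm2]; rfl
  have hRHS1 : partialPairL S (fun _ => ({1} : Multiset ℂ)) (fun _ => ({1} : Multiset ℂ)) s *
      partialPairL S (fun _ => ({1} : Multiset ℂ)) (fun v => ({εv v} : Multiset ℂ)) s =
      ∏' v : {v : HeightOneSpectrum (𝓞 K) // v ∉ S}, (fζ v.1 * fε v.1) := by
    rw [Multipliable.tprod_mul hmζ hmε]; rfl
  have hRHS2 : (partialPairL {w : HeightOneSpectrum (𝓞 L) | w.under (𝓞 K) ∈ S}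
        (fun w => ((B w).map (fun b => b⁻¹)).map (fun b => (Ω w * (ωL w)⁻¹) * b))
        (fun _ => ({1} : Multiset ℂ)) s) ^ 2 *
      partialPairL {w : HeightOneSpectrum (𝓞 L) | w.under (𝓞 K) ∈ S} B
        (fun w => (B (τ • w)).map (fun b => (ωL w)⁻¹ * b)) s =
      ∏' w : {w : HeightOneSpectrum (𝓞 L) // w.under (𝓞 K) ∉ S}, (fc w.1 ^ 2 * fb w.1) := by
    rw [Multipliable.tprod_mul (hmc.pow 2) hmb, Multipliable.tprod_pow hmc]; rfl
  rw [hLHS, mul_assoc, hRHS1, hRHS2, hreg, ← Multipliable.tprod_mul (hmζ.mul hmε) hmh]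
  refine tprod_congr fun v => ?_
  have hne : fζ v.1 * fε v.1 ≠ 0 := mul_ne_zero (hζne v.1) (hεne v.1 v.2)
  have hζ1 := hζne v.1
  have hε1 := hεne v.1 v.2
  have hv : fζ v.1 * fε v.1 * h v.1 = f₁ v.1 * f₂ v.1 := by
    rw [hh]
    field_simp
  first | exact hv | exact hv.symm

end Summit.Langlands.Langlands.Theorems.InducedSquareAscentKleinCube

end
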